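import Summits.QuantumFields.BalabanUV.Beta.GAN24.WSlotForcingZeroModeW3
import Summits.QuantumFields.BalabanUV.Beta.GAN24.WSlotForcingZeroModeRoot

/-!
# `BalabanUV.Beta.GAN24.WSlotForcingZeroModeW3Root` — binder row G-an2-4 / (CONV-C), W-slot road «W3», ROW W3-F2b IN F3b's `Zfree` CONJUNCTION FORM (covariance ∧ cell zero mode) AT THE ROOTED BORDER `vh₂SAt (toSite r) Lc` — decl-by-decl twin of leaf-18's `WSlotForcingZeroModeW3`

NOT IN PRINT; OUR PROOF ATTEMPT (row owner b2b-balaban-gan24-p1, gen 6; referee r53 (w9) ROOT ALIGNMENT, row (B) of `HOME/b2b-balaban-gan24-p1/SLOT-COVERAGE.md`: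
the β-lead's literal `MixedJetTablesPlug.JsBalAn1` / `JsBalAn1Ctr` — road BF-x's family — has an1's ROOTED border `vh₂SAt (toSite r) Lc`, `r ∈ box (d+1) Lc`, where the
W3 chain of record has the base border `vh₂S d Lc = vh₂SAt 0 Lc`).  [folklore] bookkeeping: the proofs of the base module VERBATIM, the border entering only through
an1's rooted lemmas (`MixedJetTablesPlug.hB_an1` / `hBt_an1`, `AveragingMixedJetTables.biLoc_vh₂SAt`, `T2OfDiffCovariance.vh₂SAt_inl_inl'`, leaf-19/20/11/04's
`…_at` / `…_an1` rows) instead of `T2SlotUnits.locStencil₂_vh₂S` / `vh₂S_inl_inl`.  Same theorem names as the base module, in this namespace.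
HONEST FRAMING (cell contract, verbatim): «discharging `BetaPertH` makes Bałaban's UV stability UNCONDITIONAL — a real constructive-QFT result; it is NOT the continuum
limit and NOT the Clay problem.»  HONEST DEPENDENCY (verbatim): «continuum YM on T⁴ ⇐ BetaPertH ∧ nine spine estimates (0/9 proved); BetaPertH ⇐ (D1) ∧ (D4) ∧ CAP+tail;
G-an2-4 gates asym, D1 and NE2/3/4.»  Discharges NOTHING of (hW, hWall) by itself; every row hypothesis of the base module stays a hypothesis here; 0 `def`, 0 cite,
0 `def … : Prop`, 0 sorry; NOT «W-slot closed», NEVER «G-an2-4 closed», NOT (CONV-C) for `G_k/H_k`; NOT BetaPertH, NOT continuum, NOT Clay.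
-/

noncomputable section

open Finset
open scoped BigOperators
open Literature.MathematicalPhysics.QuantumFieldTheory
open Literature.MathematicalPhysics.QuantumFieldTheory.Balaban1983to89
open Literature.MathematicalPhysics.QuantumFieldTheory.Balaban1983to89.Beta
open ExpKernelCalculus (MKer shiftK)
open OneStepResolventKernel (Fib)
open OneStepKernelFamily (KInvStep)
open StepJetData (mfNeg)
open BalabanCompositeJets (LocStencil₂)
open SecondOrderResponse (LocStencilFM W2SymOfK)
open BalabanStepJetsSucc (mmRead)
open BalabanStepW2 (K3OfK Spure M1 M2Of T2Of)
open AveragingMixedJetTables (vh₂SAt)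
open Summit.QuantumFields.BalabanUV.Beta.HessKerDressedUnits (unitK unitS)
open Summit.QuantumFields.BalabanUV.Beta.SecondOrderUnits (unitM unitS₂ unitM₂)
open Summit.QuantumFields.BalabanUV.Beta.GAN24.CombesThomas (sfStep smStep)
open Summit.QuantumFields.BalabanUV.Beta.GAN24.T2RecursionAffine (lin4)
open Summit.QuantumFields.BalabanUV.Beta.GAN24.BiStencilZeroMode (Tab zmode)
open Summit.QuantumFields.BalabanUV.Beta.GAN24.T2SlotCovariance (unitS₂_T2Of_translate_at)
open Summit.QuantumFields.BalabanUV.Beta.GAN24.Lin4ZeroMode (lin4_translate shiftK_unitKInvStep)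
open Summit.QuantumFields.BalabanUV.Beta.GAN24.WSlotForcingZeroModeRoot (forcing_zmode_eq_zero_of_source)
open Summit.QuantumFields.BalabanUV.Beta.GAN24.T2OfBracketBlockCovariance (bracket_translate_block)
open AffineAveraging (box toSite)
open Summit.QuantumFields.BalabanUV.Beta.MixedJetTablesPlug (hBt_an1)
open Summit.QuantumFields.BalabanUV.Beta.GAN24.WSlotForcingZeroModeW3 (sub_translate_pi add_translate_pi)

namespace Summit.QuantumFields.BalabanUV.Beta.GAN24.WSlotForcingZeroModeW3Root

variable {d : ℕ}


section Forcing

variable {Lc : ℕ} [NeZero Lc] {r : Fin (d + 1) → ℕ}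

/-- [folklore] **BLOCK COVARIANCE OF THE TRANSPORTED MEMBER `𝒜_j T♮_m`** (every `j, m`, every scalar): `lin4` of a jointly `Lc`-covariant table
through the block-covariant dressed step kernel is covariant under ALL coarse unit shifts (`Lin4ZeroMode.lin4_translate`), in particular under `Lc•t`. -/
theorem lin4_member_translate_block (hLc : 1 ≤ Lc) (cE cVH cΛ cE₂ cB : ℝ) (Tc : Fin 4 → Fin 4 → Fin 4 → Fin 4 → ℝ)
    {mixFF : Tab d} (hmixt : ∀ (κ : Fin (d + 1)) (u : Fin (d + 1) → ℤ) (ρ : Fin (d + 1)) (w t : Fin (d + 1) → ℤ),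
      mixFF κ (u + (Lc : ℤ) • t) ρ (w + t) = shiftK (-((Lc : ℤ) • t)) (mixFF κ u ρ w))
    (c : ℝ) (j m : ℕ) (κ : Fin (d + 1)) (u : Fin (d + 1) → ℤ) (κ' : Fin (d + 1)) (u' t : Fin (d + 1) → ℤ) :
    lin4 c (unitK (sfStep Lc j) (smStep d Lc j) (KInvStep (d := d) Lc j)) Lc
        (unitS₂ (sfStep Lc m) (smStep d Lc m) (T2Of d Lc cE cVH cΛ cE₂ cB Tc (vh₂SAt (toSite r) Lc) mixFF m)) κ (u + (Lc : ℤ) • t) κ' (u' + (Lc : ℤ) • t)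
      = shiftK (-((Lc : ℤ) • t)) (lin4 c (unitK (sfStep Lc j) (smStep d Lc j) (KInvStep (d := d) Lc j)) Lc
        (unitS₂ (sfStep Lc m) (smStep d Lc m) (T2Of d Lc cE cVH cΛ cE₂ cB Tc (vh₂SAt (toSite r) Lc) mixFF m)) κ u κ' u') :=
  lin4_translate (shiftK_unitKInvStep j) c (fun κ u κ' u' t => unitS₂_T2Of_translate_at hLc cE cVH cΛ cE₂ cB Tc (toSite r) hmixt m κ u κ' u' t)
    κ u κ' u' ((Lc : ℤ) • t)

/-- **BLOCK COVARIANCE OF THE FORCING** [folklore]: for any block-covariant source family `b` (`hbcov`), the forcing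
`f m = (𝒜_{m+1} T♮_m − 𝒜_m T♮_m) + (b (m+1) − b m)` is jointly `Lc`-covariant — the first conjunct of F3b's `Zfree`. -/
theorem forcing_translate_block (hLc : 1 ≤ Lc) (cE cVH cΛ cE₂ cB : ℝ) (Tc : Fin 4 → Fin 4 → Fin 4 → Fin 4 → ℝ)
    {mixFF : Tab d} (hmixt : ∀ (κ : Fin (d + 1)) (u : Fin (d + 1) → ℤ) (ρ : Fin (d + 1)) (w t : Fin (d + 1) → ℤ),
      mixFF κ (u + (Lc : ℤ) • t) ρ (w + t) = shiftK (-((Lc : ℤ) • t)) (mixFF κ u ρ w))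
    (b : ℕ → Tab d)
    (hbcov : ∀ (m : ℕ) (κ : Fin (d + 1)) (u : Fin (d + 1) → ℤ) (κ' : Fin (d + 1)) (u' t : Fin (d + 1) → ℤ),
      b m κ (u + (Lc : ℤ) • t) κ' (u' + (Lc : ℤ) • t) = shiftK (-((Lc : ℤ) • t)) (b m κ u κ' u'))
    (m : ℕ) (κ : Fin (d + 1)) (u : Fin (d + 1) → ℤ) (κ' : Fin (d + 1)) (u' t : Fin (d + 1) → ℤ) :
    (((lin4 (cE₂ * (Lc : ℝ) ^ (2 * (d + 1))) (unitK (sfStep Lc (m + 1)) (smStep d Lc (m + 1)) (KInvStep (d := d) Lc (m + 1))) Lc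
            (unitS₂ (sfStep Lc m) (smStep d Lc m) (T2Of d Lc cE cVH cΛ cE₂ cB Tc (vh₂SAt (toSite r) Lc) mixFF m))
          - lin4 (cE₂ * (Lc : ℝ) ^ (2 * (d + 1))) (unitK (sfStep Lc m) (smStep d Lc m) (KInvStep (d := d) Lc m)) Lc
            (unitS₂ (sfStep Lc m) (smStep d Lc m) (T2Of d Lc cE cVH cΛ cE₂ cB Tc (vh₂SAt (toSite r) Lc) mixFF m)))
        + (b (m + 1) - b m))) κ (u + (Lc : ℤ) • t) κ' (u' + (Lc : ℤ) • t)
      = shiftK (-((Lc : ℤ) • t))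
        ((((lin4 (cE₂ * (Lc : ℝ) ^ (2 * (d + 1))) (unitK (sfStep Lc (m + 1)) (smStep d Lc (m + 1)) (KInvStep (d := d) Lc (m + 1))) Lc
                (unitS₂ (sfStep Lc m) (smStep d Lc m) (T2Of d Lc cE cVH cΛ cE₂ cB Tc (vh₂SAt (toSite r) Lc) mixFF m))
              - lin4 (cE₂ * (Lc : ℝ) ^ (2 * (d + 1))) (unitK (sfStep Lc m) (smStep d Lc m) (KInvStep (d := d) Lc m)) Lc
                (unitS₂ (sfStep Lc m) (smStep d Lc m) (T2Of d Lc cE cVH cΛ cE₂ cB Tc (vh₂SAt (toSite r) Lc) mixFF m)))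
            + (b (m + 1) - b m))) κ u κ' u') :=
  add_translate_pi
    (sub_translate_pi (fun κ u κ' u' => lin4_member_translate_block hLc cE cVH cΛ cE₂ cB Tc hmixt _ (m + 1) m κ u κ' u' t)
      (fun κ u κ' u' => lin4_member_translate_block hLc cE cVH cΛ cE₂ cB Tc hmixt _ m m κ u κ' u' t))
    (sub_translate_pi (fun κ u κ' u' => hbcov (m + 1) κ u κ' u' t) (fun κ u κ' u' => hbcov m κ u κ' u' t)) κ u κ' u'

/-! ## §2 ROW W3-F2b in F3b's conjunction form (ref2 R57-2 (b)) -/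

/-- **ROW W3-F2b IN THE `Zfree` CONJUNCTION OF RECORD, GENERIC SOURCE** [folklore composition]: for any source family `b` of `LocStencil₂` tables
(`hb`, ROW W3-F4a's shape conjunct) satisfying F3b's `Zfree` conjunction (`hZ` = ROW W3-F2a: block covariance ∧ cell field–field zero mode `= 0`),
every forcing `f m` satisfies the same conjunction (covariance: §1; zero mode: PART 2's `forcing_zmode_eq_zero_of_source` at period `Lc`). -/
theorem forcing_zfreeW3_of_source (hLc : 1 ≤ Lc) (hr : r ∈ box (d + 1) Lc) (cE cVH cΛ cE₂ cB : ℝ) (Tc : Fin 4 → Fin 4 → Fin 4 → Fin 4 → ℝ)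
    {mixFF : Tab d} (hmix : ∃ C δ : ℝ, 0 < δ ∧ LocStencilFM Lc mixFF C δ)
    (hmixt : ∀ (κ : Fin (d + 1)) (u : Fin (d + 1) → ℤ) (ρ : Fin (d + 1)) (w t : Fin (d + 1) → ℤ),
      mixFF κ (u + (Lc : ℤ) • t) ρ (w + t) = shiftK (-((Lc : ℤ) • t)) (mixFF κ u ρ w))
    (b : ℕ → Tab d) {Cb δb : ℝ} (hδb : 0 < δb) (hb : ∀ m, LocStencil₂ (b m) Cb δb)
    (hZ : ∀ m, (∀ (κ : Fin (d + 1)) (u : Fin (d + 1) → ℤ) (κ' : Fin (d + 1)) (u' t : Fin (d + 1) → ℤ),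
        b m κ (u + (Lc : ℤ) • t) κ' (u' + (Lc : ℤ) • t) = shiftK (-((Lc : ℤ) • t)) (b m κ u κ' u')) ∧
      (∀ (κ κ' α β : Fin (d + 1)), zmode Lc (b m) κ κ' (Sum.inl α) (Sum.inl β) = 0))
    (m : ℕ) :
    (∀ (κ : Fin (d + 1)) (u : Fin (d + 1) → ℤ) (κ' : Fin (d + 1)) (u' t : Fin (d + 1) → ℤ),
      (((lin4 (cE₂ * (Lc : ℝ) ^ (2 * (d + 1))) (unitK (sfStep Lc (m + 1)) (smStep d Lc (m + 1)) (KInvStep (d := d) Lc (m + 1))) Lc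
              (unitS₂ (sfStep Lc m) (smStep d Lc m) (T2Of d Lc cE cVH cΛ cE₂ cB Tc (vh₂SAt (toSite r) Lc) mixFF m))
            - lin4 (cE₂ * (Lc : ℝ) ^ (2 * (d + 1))) (unitK (sfStep Lc m) (smStep d Lc m) (KInvStep (d := d) Lc m)) Lc
              (unitS₂ (sfStep Lc m) (smStep d Lc m) (T2Of d Lc cE cVH cΛ cE₂ cB Tc (vh₂SAt (toSite r) Lc) mixFF m)))
          + (b (m + 1) - b m))) κ (u + (Lc : ℤ) • t) κ' (u' + (Lc : ℤ) • t)
        = shiftK (-((Lc : ℤ) • t)) ((((lin4 (cE₂ * (Lc : ℝ) ^ (2 * (d + 1))) (unitK (sfStep Lc (m + 1)) (smStep d Lc (m + 1)) (KInvStep (d := d) Lc (m + 1))) Lc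
                  (unitS₂ (sfStep Lc m) (smStep d Lc m) (T2Of d Lc cE cVH cΛ cE₂ cB Tc (vh₂SAt (toSite r) Lc) mixFF m))
                - lin4 (cE₂ * (Lc : ℝ) ^ (2 * (d + 1))) (unitK (sfStep Lc m) (smStep d Lc m) (KInvStep (d := d) Lc m)) Lc
                  (unitS₂ (sfStep Lc m) (smStep d Lc m) (T2Of d Lc cE cVH cΛ cE₂ cB Tc (vh₂SAt (toSite r) Lc) mixFF m)))
              + (b (m + 1) - b m))) κ u κ' u')) ∧
    (∀ (κ κ' α β : Fin (d + 1)), zmode Lc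
      (((lin4 (cE₂ * (Lc : ℝ) ^ (2 * (d + 1))) (unitK (sfStep Lc (m + 1)) (smStep d Lc (m + 1)) (KInvStep (d := d) Lc (m + 1))) Lc
              (unitS₂ (sfStep Lc m) (smStep d Lc m) (T2Of d Lc cE cVH cΛ cE₂ cB Tc (vh₂SAt (toSite r) Lc) mixFF m))
            - lin4 (cE₂ * (Lc : ℝ) ^ (2 * (d + 1))) (unitK (sfStep Lc m) (smStep d Lc m) (KInvStep (d := d) Lc m)) Lc
              (unitS₂ (sfStep Lc m) (smStep d Lc m) (T2Of d Lc cE cVH cΛ cE₂ cB Tc (vh₂SAt (toSite r) Lc) mixFF m)))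
          + (b (m + 1) - b m))) κ κ' (Sum.inl α) (Sum.inl β) = 0) :=
  ⟨fun κ u κ' u' t => forcing_translate_block hLc cE cVH cΛ cE₂ cB Tc hmixt b (fun m => (hZ m).1) m κ u κ' u' t,
    fun κ κ' α β => forcing_zmode_eq_zero_of_source hLc hr Lc cE cVH cΛ cE₂ cB Tc hmix hmixt b hδb hb (fun m => (hZ m).2) m κ κ' α β⟩

/-- **ROW W3-F2b `hZf : ∀ m, Zfree (f m)` AT THE §8.3 INSTANTIATION, `Zfree` = F3b's CONJUNCTION OF RECORD (ref2 R57-2 (b)), AS A FUNCTION OF ROW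
W3-F2a IN THE SAME FORM** [folklore composition]: `b m :=` leaf-04's bracket, `f m :=` leaf-01's forcing (token for token the summand of
`T2UnitSplitLevels.unitS₂_T2Of_sub_eq_transport_add_sum_vh₂S`); hypotheses `1 ≤ Lc`, `hmix`, `hmixt`, ROW W3-F4a's shape conjunct `hb`, ROW W3-F2a `hZ`. -/
theorem hZf_of_hZ_W3 (hLc : 1 ≤ Lc) (hr : r ∈ box (d + 1) Lc) (cE cVH cΛ cE₂ cB : ℝ) (Tc : Fin 4 → Fin 4 → Fin 4 → Fin 4 → ℝ)
    {mixFF : Tab d} (hmix : ∃ C δ : ℝ, 0 < δ ∧ LocStencilFM Lc mixFF C δ)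
    (hmixt : ∀ (κ : Fin (d + 1)) (u : Fin (d + 1) → ℤ) (ρ : Fin (d + 1)) (w t : Fin (d + 1) → ℤ),
      mixFF κ (u + (Lc : ℤ) • t) ρ (w + t) = shiftK (-((Lc : ℤ) • t)) (mixFF κ u ρ w))
    {Cb δb : ℝ} (hδb : 0 < δb)
    (hb : ∀ m, LocStencil₂ (fun κ u κ' u' => (cE₂ * (Lc : ℝ) ^ (2 * (d + 1))) • mmRead Lc (K3OfK
          (unitK (sfStep Lc m) (smStep d Lc m) (KInvStep (d := d) Lc m)) Lc (unitS (sfStep Lc m) (smStep d Lc m) (Spure d Lc cE cVH cΛ m))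
          (unitM (sfStep Lc m) (smStep d Lc m) (M1 d Lc cΛ m)) (W2SymOfK (unitK (sfStep Lc m) (smStep d Lc m) (KInvStep (d := d) Lc m)) Lc
          (unitS (sfStep Lc m) (smStep d Lc m) (Spure d Lc cE cVH cΛ m)) (unitM (sfStep Lc m) (smStep d Lc m) (M1 d Lc cΛ m)) 0
          (unitM₂ (sfStep Lc m) (smStep d Lc m) (M2Of d Lc mixFF m))) κ u κ' u') + cB • mfNeg ((vh₂SAt (toSite r) Lc) κ u κ' u')) Cb δb)
    (hZ : ∀ m, (∀ (κ : Fin (d + 1)) (u : Fin (d + 1) → ℤ) (κ' : Fin (d + 1)) (u' t : Fin (d + 1) → ℤ),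
        (fun κ u κ' u' => (cE₂ * (Lc : ℝ) ^ (2 * (d + 1))) • mmRead Lc (K3OfK
            (unitK (sfStep Lc m) (smStep d Lc m) (KInvStep (d := d) Lc m)) Lc (unitS (sfStep Lc m) (smStep d Lc m) (Spure d Lc cE cVH cΛ m))
            (unitM (sfStep Lc m) (smStep d Lc m) (M1 d Lc cΛ m)) (W2SymOfK (unitK (sfStep Lc m) (smStep d Lc m) (KInvStep (d := d) Lc m)) Lc
            (unitS (sfStep Lc m) (smStep d Lc m) (Spure d Lc cE cVH cΛ m)) (unitM (sfStep Lc m) (smStep d Lc m) (M1 d Lc cΛ m)) 0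
            (unitM₂ (sfStep Lc m) (smStep d Lc m) (M2Of d Lc mixFF m))) κ u κ' u') + cB • mfNeg ((vh₂SAt (toSite r) Lc) κ u κ' u')) κ (u + (Lc : ℤ) • t) κ' (u' + (Lc : ℤ) • t)
          = shiftK (-((Lc : ℤ) • t)) ((fun κ u κ' u' => (cE₂ * (Lc : ℝ) ^ (2 * (d + 1))) • mmRead Lc (K3OfK
              (unitK (sfStep Lc m) (smStep d Lc m) (KInvStep (d := d) Lc m)) Lc (unitS (sfStep Lc m) (smStep d Lc m) (Spure d Lc cE cVH cΛ m))
              (unitM (sfStep Lc m) (smStep d Lc m) (M1 d Lc cΛ m)) (W2SymOfK (unitK (sfStep Lc m) (smStep d Lc m) (KInvStep (d := d) Lc m)) Lc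
              (unitS (sfStep Lc m) (smStep d Lc m) (Spure d Lc cE cVH cΛ m)) (unitM (sfStep Lc m) (smStep d Lc m) (M1 d Lc cΛ m)) 0
              (unitM₂ (sfStep Lc m) (smStep d Lc m) (M2Of d Lc mixFF m))) κ u κ' u') + cB • mfNeg ((vh₂SAt (toSite r) Lc) κ u κ' u')) κ u κ' u')) ∧
      (∀ (κ κ' α β : Fin (d + 1)), zmode Lc (fun κ u κ' u' => (cE₂ * (Lc : ℝ) ^ (2 * (d + 1))) • mmRead Lc (K3OfK
            (unitK (sfStep Lc m) (smStep d Lc m) (KInvStep (d := d) Lc m)) Lc (unitS (sfStep Lc m) (smStep d Lc m) (Spure d Lc cE cVH cΛ m))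
            (unitM (sfStep Lc m) (smStep d Lc m) (M1 d Lc cΛ m)) (W2SymOfK (unitK (sfStep Lc m) (smStep d Lc m) (KInvStep (d := d) Lc m)) Lc
            (unitS (sfStep Lc m) (smStep d Lc m) (Spure d Lc cE cVH cΛ m)) (unitM (sfStep Lc m) (smStep d Lc m) (M1 d Lc cΛ m)) 0
            (unitM₂ (sfStep Lc m) (smStep d Lc m) (M2Of d Lc mixFF m))) κ u κ' u') + cB • mfNeg ((vh₂SAt (toSite r) Lc) κ u κ' u')) κ κ' (Sum.inl α) (Sum.inl β) = 0))
    (m : ℕ) :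
    (∀ (κ : Fin (d + 1)) (u : Fin (d + 1) → ℤ) (κ' : Fin (d + 1)) (u' t : Fin (d + 1) → ℤ),
      (((lin4 (cE₂ * (Lc : ℝ) ^ (2 * (d + 1))) (unitK (sfStep Lc (m + 1)) (smStep d Lc (m + 1)) (KInvStep (d := d) Lc (m + 1))) Lc
              (unitS₂ (sfStep Lc m) (smStep d Lc m) (T2Of d Lc cE cVH cΛ cE₂ cB Tc (vh₂SAt (toSite r) Lc) mixFF m))
            - lin4 (cE₂ * (Lc : ℝ) ^ (2 * (d + 1))) (unitK (sfStep Lc m) (smStep d Lc m) (KInvStep (d := d) Lc m)) Lc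
              (unitS₂ (sfStep Lc m) (smStep d Lc m) (T2Of d Lc cE cVH cΛ cE₂ cB Tc (vh₂SAt (toSite r) Lc) mixFF m)))
          + ((fun κ u κ' u' => (cE₂ * (Lc : ℝ) ^ (2 * (d + 1))) • mmRead Lc (K3OfK
                (unitK (sfStep Lc (m + 1)) (smStep d Lc (m + 1)) (KInvStep (d := d) Lc (m + 1))) Lc (unitS (sfStep Lc (m + 1)) (smStep d Lc (m + 1)) (Spure d Lc cE cVH cΛ (m + 1)))
                (unitM (sfStep Lc (m + 1)) (smStep d Lc (m + 1)) (M1 d Lc cΛ (m + 1))) (W2SymOfK (unitK (sfStep Lc (m + 1)) (smStep d Lc (m + 1)) (KInvStep (d := d) Lc (m + 1))) Lc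
                (unitS (sfStep Lc (m + 1)) (smStep d Lc (m + 1)) (Spure d Lc cE cVH cΛ (m + 1))) (unitM (sfStep Lc (m + 1)) (smStep d Lc (m + 1)) (M1 d Lc cΛ (m + 1))) 0
                (unitM₂ (sfStep Lc (m + 1)) (smStep d Lc (m + 1)) (M2Of d Lc mixFF (m + 1)))) κ u κ' u') + cB • mfNeg ((vh₂SAt (toSite r) Lc) κ u κ' u'))
            - (fun κ u κ' u' => (cE₂ * (Lc : ℝ) ^ (2 * (d + 1))) • mmRead Lc (K3OfK
                (unitK (sfStep Lc m) (smStep d Lc m) (KInvStep (d := d) Lc m)) Lc (unitS (sfStep Lc m) (smStep d Lc m) (Spure d Lc cE cVH cΛ m))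
                (unitM (sfStep Lc m) (smStep d Lc m) (M1 d Lc cΛ m)) (W2SymOfK (unitK (sfStep Lc m) (smStep d Lc m) (KInvStep (d := d) Lc m)) Lc
                (unitS (sfStep Lc m) (smStep d Lc m) (Spure d Lc cE cVH cΛ m)) (unitM (sfStep Lc m) (smStep d Lc m) (M1 d Lc cΛ m)) 0
                (unitM₂ (sfStep Lc m) (smStep d Lc m) (M2Of d Lc mixFF m))) κ u κ' u') + cB • mfNeg ((vh₂SAt (toSite r) Lc) κ u κ' u'))))) κ (u + (Lc : ℤ) • t) κ' (u' + (Lc : ℤ) • t)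
        = shiftK (-((Lc : ℤ) • t)) ((((lin4 (cE₂ * (Lc : ℝ) ^ (2 * (d + 1))) (unitK (sfStep Lc (m + 1)) (smStep d Lc (m + 1)) (KInvStep (d := d) Lc (m + 1))) Lc
                  (unitS₂ (sfStep Lc m) (smStep d Lc m) (T2Of d Lc cE cVH cΛ cE₂ cB Tc (vh₂SAt (toSite r) Lc) mixFF m))
                - lin4 (cE₂ * (Lc : ℝ) ^ (2 * (d + 1))) (unitK (sfStep Lc m) (smStep d Lc m) (KInvStep (d := d) Lc m)) Lc
                  (unitS₂ (sfStep Lc m) (smStep d Lc m) (T2Of d Lc cE cVH cΛ cE₂ cB Tc (vh₂SAt (toSite r) Lc) mixFF m)))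
              + ((fun κ u κ' u' => (cE₂ * (Lc : ℝ) ^ (2 * (d + 1))) • mmRead Lc (K3OfK
                    (unitK (sfStep Lc (m + 1)) (smStep d Lc (m + 1)) (KInvStep (d := d) Lc (m + 1))) Lc (unitS (sfStep Lc (m + 1)) (smStep d Lc (m + 1)) (Spure d Lc cE cVH cΛ (m + 1)))
                    (unitM (sfStep Lc (m + 1)) (smStep d Lc (m + 1)) (M1 d Lc cΛ (m + 1))) (W2SymOfK (unitK (sfStep Lc (m + 1)) (smStep d Lc (m + 1)) (KInvStep (d := d) Lc (m + 1))) Lc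
                    (unitS (sfStep Lc (m + 1)) (smStep d Lc (m + 1)) (Spure d Lc cE cVH cΛ (m + 1))) (unitM (sfStep Lc (m + 1)) (smStep d Lc (m + 1)) (M1 d Lc cΛ (m + 1))) 0
                    (unitM₂ (sfStep Lc (m + 1)) (smStep d Lc (m + 1)) (M2Of d Lc mixFF (m + 1)))) κ u κ' u') + cB • mfNeg ((vh₂SAt (toSite r) Lc) κ u κ' u'))
                - (fun κ u κ' u' => (cE₂ * (Lc : ℝ) ^ (2 * (d + 1))) • mmRead Lc (K3OfK
                    (unitK (sfStep Lc m) (smStep d Lc m) (KInvStep (d := d) Lc m)) Lc (unitS (sfStep Lc m) (smStep d Lc m) (Spure d Lc cE cVH cΛ m))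
                    (unitM (sfStep Lc m) (smStep d Lc m) (M1 d Lc cΛ m)) (W2SymOfK (unitK (sfStep Lc m) (smStep d Lc m) (KInvStep (d := d) Lc m)) Lc
                    (unitS (sfStep Lc m) (smStep d Lc m) (Spure d Lc cE cVH cΛ m)) (unitM (sfStep Lc m) (smStep d Lc m) (M1 d Lc cΛ m)) 0
                    (unitM₂ (sfStep Lc m) (smStep d Lc m) (M2Of d Lc mixFF m))) κ u κ' u') + cB • mfNeg ((vh₂SAt (toSite r) Lc) κ u κ' u'))))) κ u κ' u')) ∧
    (∀ (κ κ' α β : Fin (d + 1)), zmode Lc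
      (((lin4 (cE₂ * (Lc : ℝ) ^ (2 * (d + 1))) (unitK (sfStep Lc (m + 1)) (smStep d Lc (m + 1)) (KInvStep (d := d) Lc (m + 1))) Lc
              (unitS₂ (sfStep Lc m) (smStep d Lc m) (T2Of d Lc cE cVH cΛ cE₂ cB Tc (vh₂SAt (toSite r) Lc) mixFF m))
            - lin4 (cE₂ * (Lc : ℝ) ^ (2 * (d + 1))) (unitK (sfStep Lc m) (smStep d Lc m) (KInvStep (d := d) Lc m)) Lc
              (unitS₂ (sfStep Lc m) (smStep d Lc m) (T2Of d Lc cE cVH cΛ cE₂ cB Tc (vh₂SAt (toSite r) Lc) mixFF m)))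
          + ((fun κ u κ' u' => (cE₂ * (Lc : ℝ) ^ (2 * (d + 1))) • mmRead Lc (K3OfK
                (unitK (sfStep Lc (m + 1)) (smStep d Lc (m + 1)) (KInvStep (d := d) Lc (m + 1))) Lc (unitS (sfStep Lc (m + 1)) (smStep d Lc (m + 1)) (Spure d Lc cE cVH cΛ (m + 1)))
                (unitM (sfStep Lc (m + 1)) (smStep d Lc (m + 1)) (M1 d Lc cΛ (m + 1))) (W2SymOfK (unitK (sfStep Lc (m + 1)) (smStep d Lc (m + 1)) (KInvStep (d := d) Lc (m + 1))) Lc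
                (unitS (sfStep Lc (m + 1)) (smStep d Lc (m + 1)) (Spure d Lc cE cVH cΛ (m + 1))) (unitM (sfStep Lc (m + 1)) (smStep d Lc (m + 1)) (M1 d Lc cΛ (m + 1))) 0
                (unitM₂ (sfStep Lc (m + 1)) (smStep d Lc (m + 1)) (M2Of d Lc mixFF (m + 1)))) κ u κ' u') + cB • mfNeg ((vh₂SAt (toSite r) Lc) κ u κ' u'))
            - (fun κ u κ' u' => (cE₂ * (Lc : ℝ) ^ (2 * (d + 1))) • mmRead Lc (K3OfK
                (unitK (sfStep Lc m) (smStep d Lc m) (KInvStep (d := d) Lc m)) Lc (unitS (sfStep Lc m) (smStep d Lc m) (Spure d Lc cE cVH cΛ m))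
                (unitM (sfStep Lc m) (smStep d Lc m) (M1 d Lc cΛ m)) (W2SymOfK (unitK (sfStep Lc m) (smStep d Lc m) (KInvStep (d := d) Lc m)) Lc
                (unitS (sfStep Lc m) (smStep d Lc m) (Spure d Lc cE cVH cΛ m)) (unitM (sfStep Lc m) (smStep d Lc m) (M1 d Lc cΛ m)) 0
                (unitM₂ (sfStep Lc m) (smStep d Lc m) (M2Of d Lc mixFF m))) κ u κ' u') + cB • mfNeg ((vh₂SAt (toSite r) Lc) κ u κ' u'))))) κ κ' (Sum.inl α) (Sum.inl β) = 0) :=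
  forcing_zfreeW3_of_source hLc hr cE cVH cΛ cE₂ cB Tc hmix hmixt
    (fun j => (fun κ u κ' u' => (cE₂ * (Lc : ℝ) ^ (2 * (d + 1))) • mmRead Lc (K3OfK
        (unitK (sfStep Lc j) (smStep d Lc j) (KInvStep (d := d) Lc j)) Lc (unitS (sfStep Lc j) (smStep d Lc j) (Spure d Lc cE cVH cΛ j))
        (unitM (sfStep Lc j) (smStep d Lc j) (M1 d Lc cΛ j)) (W2SymOfK (unitK (sfStep Lc j) (smStep d Lc j) (KInvStep (d := d) Lc j)) Lc
        (unitS (sfStep Lc j) (smStep d Lc j) (Spure d Lc cE cVH cΛ j)) (unitM (sfStep Lc j) (smStep d Lc j) (M1 d Lc cΛ j)) 0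
        (unitM₂ (sfStep Lc j) (smStep d Lc j) (M2Of d Lc mixFF j))) κ u κ' u') + cB • mfNeg ((vh₂SAt (toSite r) Lc) κ u κ' u'))) hδb hb hZ m

/-- **THE SAME TAKING ONLY ROW W3-F2a's ZERO-MODE CONJUNCT** [folklore composition]: the covariance conjunct of leaf-04's bracket is leaf-11's tree
theorem `T2OfBracketBlockCovariance.bracket_translate_block_base` (binder `hmixt`), so F2a may be fed in the cell zero-mode form alone. -/
theorem hZf_of_hZcell_W3 (hLc : 1 ≤ Lc) (hr : r ∈ box (d + 1) Lc) (cE cVH cΛ cE₂ cB : ℝ) (Tc : Fin 4 → Fin 4 → Fin 4 → Fin 4 → ℝ)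
    {mixFF : Tab d} (hmix : ∃ C δ : ℝ, 0 < δ ∧ LocStencilFM Lc mixFF C δ)
    (hmixt : ∀ (κ : Fin (d + 1)) (u : Fin (d + 1) → ℤ) (ρ : Fin (d + 1)) (w t : Fin (d + 1) → ℤ),
      mixFF κ (u + (Lc : ℤ) • t) ρ (w + t) = shiftK (-((Lc : ℤ) • t)) (mixFF κ u ρ w))
    {Cb δb : ℝ} (hδb : 0 < δb)
    (hb : ∀ m, LocStencil₂ (fun κ u κ' u' => (cE₂ * (Lc : ℝ) ^ (2 * (d + 1))) • mmRead Lc (K3OfK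
          (unitK (sfStep Lc m) (smStep d Lc m) (KInvStep (d := d) Lc m)) Lc (unitS (sfStep Lc m) (smStep d Lc m) (Spure d Lc cE cVH cΛ m))
          (unitM (sfStep Lc m) (smStep d Lc m) (M1 d Lc cΛ m)) (W2SymOfK (unitK (sfStep Lc m) (smStep d Lc m) (KInvStep (d := d) Lc m)) Lc
          (unitS (sfStep Lc m) (smStep d Lc m) (Spure d Lc cE cVH cΛ m)) (unitM (sfStep Lc m) (smStep d Lc m) (M1 d Lc cΛ m)) 0
          (unitM₂ (sfStep Lc m) (smStep d Lc m) (M2Of d Lc mixFF m))) κ u κ' u') + cB • mfNeg ((vh₂SAt (toSite r) Lc) κ u κ' u')) Cb δb)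
    (hZ : ∀ (m : ℕ) (κ κ' α β : Fin (d + 1)), zmode Lc (fun κ u κ' u' => (cE₂ * (Lc : ℝ) ^ (2 * (d + 1))) • mmRead Lc (K3OfK
            (unitK (sfStep Lc m) (smStep d Lc m) (KInvStep (d := d) Lc m)) Lc (unitS (sfStep Lc m) (smStep d Lc m) (Spure d Lc cE cVH cΛ m))
            (unitM (sfStep Lc m) (smStep d Lc m) (M1 d Lc cΛ m)) (W2SymOfK (unitK (sfStep Lc m) (smStep d Lc m) (KInvStep (d := d) Lc m)) Lc
            (unitS (sfStep Lc m) (smStep d Lc m) (Spure d Lc cE cVH cΛ m)) (unitM (sfStep Lc m) (smStep d Lc m) (M1 d Lc cΛ m)) 0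
            (unitM₂ (sfStep Lc m) (smStep d Lc m) (M2Of d Lc mixFF m))) κ u κ' u') + cB • mfNeg ((vh₂SAt (toSite r) Lc) κ u κ' u')) κ κ' (Sum.inl α) (Sum.inl β) = 0)
    (m : ℕ) :
    (∀ (κ : Fin (d + 1)) (u : Fin (d + 1) → ℤ) (κ' : Fin (d + 1)) (u' t : Fin (d + 1) → ℤ),
      (((lin4 (cE₂ * (Lc : ℝ) ^ (2 * (d + 1))) (unitK (sfStep Lc (m + 1)) (smStep d Lc (m + 1)) (KInvStep (d := d) Lc (m + 1))) Lc
              (unitS₂ (sfStep Lc m) (smStep d Lc m) (T2Of d Lc cE cVH cΛ cE₂ cB Tc (vh₂SAt (toSite r) Lc) mixFF m))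
            - lin4 (cE₂ * (Lc : ℝ) ^ (2 * (d + 1))) (unitK (sfStep Lc m) (smStep d Lc m) (KInvStep (d := d) Lc m)) Lc
              (unitS₂ (sfStep Lc m) (smStep d Lc m) (T2Of d Lc cE cVH cΛ cE₂ cB Tc (vh₂SAt (toSite r) Lc) mixFF m)))
          + ((fun κ u κ' u' => (cE₂ * (Lc : ℝ) ^ (2 * (d + 1))) • mmRead Lc (K3OfK
                (unitK (sfStep Lc (m + 1)) (smStep d Lc (m + 1)) (KInvStep (d := d) Lc (m + 1))) Lc (unitS (sfStep Lc (m + 1)) (smStep d Lc (m + 1)) (Spure d Lc cE cVH cΛ (m + 1)))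
                (unitM (sfStep Lc (m + 1)) (smStep d Lc (m + 1)) (M1 d Lc cΛ (m + 1))) (W2SymOfK (unitK (sfStep Lc (m + 1)) (smStep d Lc (m + 1)) (KInvStep (d := d) Lc (m + 1))) Lc
                (unitS (sfStep Lc (m + 1)) (smStep d Lc (m + 1)) (Spure d Lc cE cVH cΛ (m + 1))) (unitM (sfStep Lc (m + 1)) (smStep d Lc (m + 1)) (M1 d Lc cΛ (m + 1))) 0
                (unitM₂ (sfStep Lc (m + 1)) (smStep d Lc (m + 1)) (M2Of d Lc mixFF (m + 1)))) κ u κ' u') + cB • mfNeg ((vh₂SAt (toSite r) Lc) κ u κ' u'))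
            - (fun κ u κ' u' => (cE₂ * (Lc : ℝ) ^ (2 * (d + 1))) • mmRead Lc (K3OfK
                (unitK (sfStep Lc m) (smStep d Lc m) (KInvStep (d := d) Lc m)) Lc (unitS (sfStep Lc m) (smStep d Lc m) (Spure d Lc cE cVH cΛ m))
                (unitM (sfStep Lc m) (smStep d Lc m) (M1 d Lc cΛ m)) (W2SymOfK (unitK (sfStep Lc m) (smStep d Lc m) (KInvStep (d := d) Lc m)) Lc
                (unitS (sfStep Lc m) (smStep d Lc m) (Spure d Lc cE cVH cΛ m)) (unitM (sfStep Lc m) (smStep d Lc m) (M1 d Lc cΛ m)) 0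
                (unitM₂ (sfStep Lc m) (smStep d Lc m) (M2Of d Lc mixFF m))) κ u κ' u') + cB • mfNeg ((vh₂SAt (toSite r) Lc) κ u κ' u'))))) κ (u + (Lc : ℤ) • t) κ' (u' + (Lc : ℤ) • t)
        = shiftK (-((Lc : ℤ) • t)) ((((lin4 (cE₂ * (Lc : ℝ) ^ (2 * (d + 1))) (unitK (sfStep Lc (m + 1)) (smStep d Lc (m + 1)) (KInvStep (d := d) Lc (m + 1))) Lc
                  (unitS₂ (sfStep Lc m) (smStep d Lc m) (T2Of d Lc cE cVH cΛ cE₂ cB Tc (vh₂SAt (toSite r) Lc) mixFF m))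
                - lin4 (cE₂ * (Lc : ℝ) ^ (2 * (d + 1))) (unitK (sfStep Lc m) (smStep d Lc m) (KInvStep (d := d) Lc m)) Lc
                  (unitS₂ (sfStep Lc m) (smStep d Lc m) (T2Of d Lc cE cVH cΛ cE₂ cB Tc (vh₂SAt (toSite r) Lc) mixFF m)))
              + ((fun κ u κ' u' => (cE₂ * (Lc : ℝ) ^ (2 * (d + 1))) • mmRead Lc (K3OfK
                    (unitK (sfStep Lc (m + 1)) (smStep d Lc (m + 1)) (KInvStep (d := d) Lc (m + 1))) Lc (unitS (sfStep Lc (m + 1)) (smStep d Lc (m + 1)) (Spure d Lc cE cVH cΛ (m + 1)))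
                    (unitM (sfStep Lc (m + 1)) (smStep d Lc (m + 1)) (M1 d Lc cΛ (m + 1))) (W2SymOfK (unitK (sfStep Lc (m + 1)) (smStep d Lc (m + 1)) (KInvStep (d := d) Lc (m + 1))) Lc
                    (unitS (sfStep Lc (m + 1)) (smStep d Lc (m + 1)) (Spure d Lc cE cVH cΛ (m + 1))) (unitM (sfStep Lc (m + 1)) (smStep d Lc (m + 1)) (M1 d Lc cΛ (m + 1))) 0
                    (unitM₂ (sfStep Lc (m + 1)) (smStep d Lc (m + 1)) (M2Of d Lc mixFF (m + 1)))) κ u κ' u') + cB • mfNeg ((vh₂SAt (toSite r) Lc) κ u κ' u'))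
                - (fun κ u κ' u' => (cE₂ * (Lc : ℝ) ^ (2 * (d + 1))) • mmRead Lc (K3OfK
                    (unitK (sfStep Lc m) (smStep d Lc m) (KInvStep (d := d) Lc m)) Lc (unitS (sfStep Lc m) (smStep d Lc m) (Spure d Lc cE cVH cΛ m))
                    (unitM (sfStep Lc m) (smStep d Lc m) (M1 d Lc cΛ m)) (W2SymOfK (unitK (sfStep Lc m) (smStep d Lc m) (KInvStep (d := d) Lc m)) Lc
                    (unitS (sfStep Lc m) (smStep d Lc m) (Spure d Lc cE cVH cΛ m)) (unitM (sfStep Lc m) (smStep d Lc m) (M1 d Lc cΛ m)) 0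
                    (unitM₂ (sfStep Lc m) (smStep d Lc m) (M2Of d Lc mixFF m))) κ u κ' u') + cB • mfNeg ((vh₂SAt (toSite r) Lc) κ u κ' u'))))) κ u κ' u')) ∧
    (∀ (κ κ' α β : Fin (d + 1)), zmode Lc
      (((lin4 (cE₂ * (Lc : ℝ) ^ (2 * (d + 1))) (unitK (sfStep Lc (m + 1)) (smStep d Lc (m + 1)) (KInvStep (d := d) Lc (m + 1))) Lc
              (unitS₂ (sfStep Lc m) (smStep d Lc m) (T2Of d Lc cE cVH cΛ cE₂ cB Tc (vh₂SAt (toSite r) Lc) mixFF m))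
            - lin4 (cE₂ * (Lc : ℝ) ^ (2 * (d + 1))) (unitK (sfStep Lc m) (smStep d Lc m) (KInvStep (d := d) Lc m)) Lc
              (unitS₂ (sfStep Lc m) (smStep d Lc m) (T2Of d Lc cE cVH cΛ cE₂ cB Tc (vh₂SAt (toSite r) Lc) mixFF m)))
          + ((fun κ u κ' u' => (cE₂ * (Lc : ℝ) ^ (2 * (d + 1))) • mmRead Lc (K3OfK
                (unitK (sfStep Lc (m + 1)) (smStep d Lc (m + 1)) (KInvStep (d := d) Lc (m + 1))) Lc (unitS (sfStep Lc (m + 1)) (smStep d Lc (m + 1)) (Spure d Lc cE cVH cΛ (m + 1)))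
                (unitM (sfStep Lc (m + 1)) (smStep d Lc (m + 1)) (M1 d Lc cΛ (m + 1))) (W2SymOfK (unitK (sfStep Lc (m + 1)) (smStep d Lc (m + 1)) (KInvStep (d := d) Lc (m + 1))) Lc
                (unitS (sfStep Lc (m + 1)) (smStep d Lc (m + 1)) (Spure d Lc cE cVH cΛ (m + 1))) (unitM (sfStep Lc (m + 1)) (smStep d Lc (m + 1)) (M1 d Lc cΛ (m + 1))) 0
                (unitM₂ (sfStep Lc (m + 1)) (smStep d Lc (m + 1)) (M2Of d Lc mixFF (m + 1)))) κ u κ' u') + cB • mfNeg ((vh₂SAt (toSite r) Lc) κ u κ' u'))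
            - (fun κ u κ' u' => (cE₂ * (Lc : ℝ) ^ (2 * (d + 1))) • mmRead Lc (K3OfK
                (unitK (sfStep Lc m) (smStep d Lc m) (KInvStep (d := d) Lc m)) Lc (unitS (sfStep Lc m) (smStep d Lc m) (Spure d Lc cE cVH cΛ m))
                (unitM (sfStep Lc m) (smStep d Lc m) (M1 d Lc cΛ m)) (W2SymOfK (unitK (sfStep Lc m) (smStep d Lc m) (KInvStep (d := d) Lc m)) Lc
                (unitS (sfStep Lc m) (smStep d Lc m) (Spure d Lc cE cVH cΛ m)) (unitM (sfStep Lc m) (smStep d Lc m) (M1 d Lc cΛ m)) 0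
                (unitM₂ (sfStep Lc m) (smStep d Lc m) (M2Of d Lc mixFF m))) κ u κ' u') + cB • mfNeg ((vh₂SAt (toSite r) Lc) κ u κ' u'))))) κ κ' (Sum.inl α) (Sum.inl β) = 0) :=
  hZf_of_hZ_W3 hLc hr cE cVH cΛ cE₂ cB Tc hmix hmixt hδb hb
    (fun m => ⟨fun κ u κ' u' t => bracket_translate_block hLc cE cVH cΛ hmixt (hBt_an1 hLc (toSite r)) cE₂ cB m κ u κ' u' t, hZ m⟩) m

end Forcing

end Summit.QuantumFields.BalabanUV.Beta.GAN24.WSlotForcingZeroModeW3Root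

end
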